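import Summits.BirchSwinnertonDyer.BirchSwinnertonDyer.Theorems.KolyvaginDepthDoorKolyvaginDepthSupplyDoorOfSystem
import HarnessLib

/-!
# Route `KolyvaginDepthDoor`, crux `KolyvaginDepthSupply` (stmt-BirchSwinnertonDyer-21765) —
# the door without Kolyvagin's structure theorem on the crux's objects, READ against rational points

Helper file (`--supports stmt-BirchSwinnertonDyer-21765 --as helper`); it closes nothing and BSD is
not proved by it. Second half of `…KolyvaginDepthSupplyDoorOfSystem` (split for the 400-line rule):
the Selmer count `#Sel(E/K)_p ≤ p^{2ν+1}` delivered there from ONE non-zero class of a system of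
Kolyvagin–Heegner data (`natCard_selmerGroup_le_of_kolyvaginClass_ne_zero_of_system`, Kolyvagin's
minimal-depth descent, hypotheses = Gross Prop. 5.4 (2), McCallum Lemma 4.3 / Prop. 4.4, Gross
Prop. 8.1 (1) and the reciprocity law at finitely many Kolyvagin places, all in the crux's currency;
Čebotarev = tree theorem) is read by the UNCONDITIONAL
`rank_and_shaCorank_of_natCard_selmerGroup_baseChange_le` (file `…SelmerCountReading`) at the prime
`p^1 = p`:

* `shaCorank_eq_zero_of_kolyvaginClass_ne_zero_of_points_of_system` — `(d n).kolyvaginClass hp 1 ≠ 0`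
  at depth `ν`, `a ≤ rank E(ℚ)`, `b ≤ rank E^{(d_K)}(ℚ)`, `a + b = 2ν + 1` ⟹ `t_p(E) = 0`,
  `t_p(E^{(d_K)}) = 0`, `rank E = a`, `rank E^{(d_K)} = b` (both rank clauses of the crux);
* `shaCorank_eq_zero_of_rank_two_of_kolyvaginClass_prime_ne_zero_of_system` — THE DEPTH-TABLE ROW
  WITHOUT `hF`: the bit `(d ℓ).kolyvaginClass hp 1 ≠ 0` at one Kolyvagin prime (Zhang's form), two
  points on `E(ℚ)`, one point of infinite order on `E^{(d_K)}(ℚ)` ⟹ `t_p(E) = 0`, `rank E = 2`,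
  `rank E^{(d_K)} = 1`.

Trust base: as in the sibling (hypotheses `hτc`, `hfin`, `hinf`, `h44`, `hcyc`, `hdual` — printed
statements about Kolyvagin's classes, Gross 1991 §§5–8 / McCallum 1991 §§2–5; tower surjectivity;
the point certificates). NOT used: Kolyvagin 1991 Thm. 4. Per-curve; BSD is not proved by it.

References: [GrossLMS1991] §§5–10; [McCallumLMS1991] §§2–5; [Kolyvagin1991MathAnn] Thm. 2.3;
[JetchevLauterStein2009] §3.6; [SilvermanAEC2009] X.4.2.
-/

set_option linter.dupNamespace false

noncomputable section

open scoped Classical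

namespace Summit.BirchSwinnertonDyer.BirchSwinnertonDyer.Theorems.KolyvaginDepthDoor

open Literature.NumberTheory.EllipticCurves Literature.NumberTheory.EllipticCurves.ModularForms
  Literature.NumberTheory.EllipticCurves.KolyvaginDescent WeierstrassCurve NumberField
  IsDedekindDomain

section System

variable {W : WeierstrassCurve ℚ} [W.IsElliptic] [W.IsGloballyMinimal] [NeZero (W.conductorNorm ℤ)]
  {K : Type} [Field K] [NumberField K]
  {Dt : ModularParametrizationData W (W.conductorNorm ℤ)} {β : ℤ} {ι : K →+* ℂ}

/-- **The door without Kolyvagin's structure theorem, on the crux's objects (both rank clauses).**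
In the setting of `exists_hypothesesDepth_of_system`: if `(d n).kolyvaginClass hp 1 ≠ 0` for a
square-free product `n` of Kolyvagin primes with `ν` prime factors and `a ≤ rank E(ℚ)`,
`b ≤ rank E^{(d_K)}(ℚ)` with `a + b = 2ν + 1`, then `corank_{ℤ_p} Ш(E/ℚ)[p^∞] = 0`,
`corank_{ℤ_p} Ш(E^{(d_K)}/ℚ)[p^∞] = 0`, `rank E(ℚ) = a` and `rank E^{(d_K)}(ℚ) = b`
(`natCard_selmerGroup_le_of_kolyvaginClass_ne_zero_of_system` read by
`rank_and_shaCorank_of_natCard_selmerGroup_baseChange_le` at the prime `p^1 = p`). Crux clause 1: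
`(a, b) = (ν+1, ν)`; clause 2: `(a, b) = (ν, ν+1)`. CONDITIONAL on the displayed hypotheses;
per-curve; BSD is not proved by it. [cite: Kolyvagin1991MathAnn, Thm. 2.3]
[cite: GrossLMS1991, §10] [cite: SilvermanAEC2009, Thm X.4.2] -/
theorem shaCorank_eq_zero_of_kolyvaginClass_ne_zero_of_points_of_system (hcm : ¬ W.HasCM)
    (hK : IsImaginaryQuadratic K) (p : ℕ) [hp : Fact p.Prime] (hp2 : p ≠ 2)
    (htower : ∀ n : ℕ, W.HasSurjectiveModNGaloisRep (p ^ n : ℕ))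
    (c : K ≃ₐ[ℚ] K) (hc : c ≠ 1) (hcc : c * c = 1)
    (d : ∀ n : ℕ, KolyvaginHeegnerData Dt β ι n) (ε : ℤ) (hε : ε = 1 ∨ ε = -1)
    (hτc : ∀ n : ℕ, Squarefree n →
      (∀ q ∈ n.primeFactors, Zhang2014.IsKolyvaginPrime (W.conductorNorm ℤ) W K p q) →
      conjAct W c ((p ^ 1 : ℕ) : ℤ) ((d n).kolyvaginClass hp.out 1) =
        (ε * (-1) ^ n.primeFactors.card) • (d n).kolyvaginClass hp.out 1)
    (hfin : ∀ n : ℕ, Squarefree n →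
      (∀ q ∈ n.primeFactors, Zhang2014.IsKolyvaginPrime (W.conductorNorm ℤ) W K p q) →
      ∀ v : HeightOneSpectrum (𝓞 K), (n : 𝓞 K) ∉ v.asIdeal →
        (d n).kolyvaginClass hp.out 1 ∈
          selmerLocalKer (W.baseChange K) (v.adicCompletion K) ((p ^ 1 : ℕ) : ℤ))
    (hinf : ∀ n : ℕ, Squarefree n →
      (∀ q ∈ n.primeFactors, Zhang2014.IsKolyvaginPrime (W.conductorNorm ℤ) W K p q) →
      ∀ w : InfinitePlace K,
        (d n).kolyvaginClass hp.out 1 ∈ selmerLocalKer (W.baseChange K) w.Completion ((p ^ 1 : ℕ) : ℤ))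
    (h44 : ∀ (ℓ m : ℕ), Squarefree (ℓ * m) →
      (∀ q ∈ (ℓ * m).primeFactors, Zhang2014.IsKolyvaginPrime (W.conductorNorm ℤ) W K p q) →
      Zhang2014.IsKolyvaginPrime (W.conductorNorm ℤ) W K p ℓ →
      ∀ v : HeightOneSpectrum (𝓞 K), (ℓ : 𝓞 K) ∈ v.asIdeal →
        ((d (ℓ * m)).kolyvaginClass hp.out 1 ∈
            selmerLocalKer (W.baseChange K) (v.adicCompletion K) ((p ^ 1 : ℕ) : ℤ) ↔
          (d m).kolyvaginClass hp.out 1 ∈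
            (W.baseChange K).torsionLocalKer (v.adicCompletion K) ((p ^ 1 : ℕ) : ℤ)))
    (hcyc : ∀ ℓ : ℕ, Zhang2014.IsKolyvaginPrime (W.conductorNorm ℤ) W K p ℓ →
      ∀ e : ℤ, (e = 1 ∨ e = -1) →
      ∀ s₁ ∈ selmerGroup (W.baseChange K) ((p ^ 1 : ℕ) : ℤ),
        conjAct W c ((p ^ 1 : ℕ) : ℤ) s₁ = e • s₁ →
      ∀ s₂ ∈ selmerGroup (W.baseChange K) ((p ^ 1 : ℕ) : ℤ),
        conjAct W c ((p ^ 1 : ℕ) : ℤ) s₂ = e • s₂ →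
      ∃ a b : ℤ, ¬ ((p : ℤ) ∣ a ∧ (p : ℤ) ∣ b) ∧
        ∀ v : HeightOneSpectrum (𝓞 K), (ℓ : 𝓞 K) ∈ v.asIdeal →
          a • s₁ + b • s₂ ∈ (W.baseChange K).torsionLocalKer (v.adicCompletion K) ((p ^ 1 : ℕ) : ℤ))
    (hdual : ∀ (T : Finset ℕ), (∀ q ∈ T, Zhang2014.IsKolyvaginPrime (W.conductorNorm ℤ) W K p q) →
      ∀ ℓ ∈ T, ∀ e : ℤ, (e = 1 ∨ e = -1) →
      ∀ x : galH1Torsion (W.baseChange K) ((p ^ 1 : ℕ) : ℤ),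
        conjAct W c ((p ^ 1 : ℕ) : ℤ) x = e • x →
        (∀ v : HeightOneSpectrum (𝓞 K), (∀ q ∈ T, (q : 𝓞 K) ∉ v.asIdeal) →
          x ∈ selmerLocalKer (W.baseChange K) (v.adicCompletion K) ((p ^ 1 : ℕ) : ℤ)) →
        (∀ w : InfinitePlace K, x ∈ selmerLocalKer (W.baseChange K) w.Completion ((p ^ 1 : ℕ) : ℤ)) →
      ∀ s ∈ selmerGroup (W.baseChange K) ((p ^ 1 : ℕ) : ℤ),
        conjAct W c ((p ^ 1 : ℕ) : ℤ) s = e • s →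
        (∀ q ∈ T, q ≠ ℓ → ∀ v : HeightOneSpectrum (𝓞 K), (q : 𝓞 K) ∈ v.asIdeal →
          s ∈ (W.baseChange K).torsionLocalKer (v.adicCompletion K) ((p ^ 1 : ℕ) : ℤ)) →
        ∀ v : HeightOneSpectrum (𝓞 K), (ℓ : 𝓞 K) ∈ v.asIdeal →
          s ∉ (W.baseChange K).torsionLocalKer (v.adicCompletion K) ((p ^ 1 : ℕ) : ℤ) →
          x ∈ selmerLocalKer (W.baseChange K) (v.adicCompletion K) ((p ^ 1 : ℕ) : ℤ))
    {n : ℕ} (hn : Squarefree n)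
    (hkn : ∀ q ∈ n.primeFactors, Zhang2014.IsKolyvaginPrime (W.conductorNorm ℤ) W K p q)
    (hne : (d n).kolyvaginClass hp.out 1 ≠ 0) (a b : ℕ) (hab : a + b = 2 * n.primeFactors.card + 1)
    (ha : a ≤ W.mordellWeilRank)
    (hb : b ≤ (W.quadraticTwist (NumberField.discr K : ℚ)).mordellWeilRank) :
    W.shaCorank p = 0 ∧ (W.quadraticTwist (NumberField.discr K : ℚ)).shaCorank p = 0 ∧
      W.mordellWeilRank = a ∧ (W.quadraticTwist (NumberField.discr K : ℚ)).mordellWeilRank = b := by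
  obtain ⟨-, hcard⟩ := natCard_selmerGroup_le_of_kolyvaginClass_ne_zero_of_system hcm hK p hp2
    htower c hc hcc d ε hε hτc hfin hinf h44 hcyc hdual hn hkn hne
  -- read the count at the prime `p^1 = p`
  haveI hp1 : Fact (p ^ 1).Prime := ⟨by rw [pow_one]; exact hp.out⟩
  have hcard' : Nat.card ↥(selmerGroup (W.baseChange K) ((p ^ 1 : ℕ) : ℤ)) ≤ (p ^ 1) ^ (a + b) := by
    rw [pow_one, hab]
    rw [pow_one] at hcard
    exact hcard
  obtain ⟨hra, hrb, -, -, -, hsha, hshaT⟩ :=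
    rank_and_shaCorank_of_natCard_selmerGroup_baseChange_le W K hK.1 (p ^ 1) a b hcard' ha hb
  rw [pow_one] at hsha hshaT
  exact ⟨hsha, hshaT, hra, hrb⟩

/-- **The depth-table row without `hF`, on the crux's objects.** In the setting of
`exists_hypothesesDepth_of_system`: ONE Kolyvagin prime `ℓ` (Zhang's congruence form, as in the
route's depth table: `ℓ ∤ N_E d_K p`, `ℓ` inert, `p ∣ ℓ + 1`, `p ∣ a_ℓ`) whose first derived class
does not vanish, `(d ℓ).kolyvaginClass hp 1 ≠ 0` — the bit a depth table computes
(Jetchev–Lauter–Stein: `P(ℓ) ∉ pE(K[ℓ])`) —, two independent points on `E(ℚ)` and one point of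
infinite order on `E^{(d_K)}(ℚ)` give `corank_{ℤ_p} Ш(E/ℚ)[p^∞] = 0`, `rank E(ℚ) = 2`,
`rank E^{(d_K)}(ℚ) = 1` and `corank Ш(E^{(d_K)}/ℚ)[p^∞] = 0`. This is the row certificate
`shaCorank_eq_zero_of_rank_two_of_kolyvaginClass_prime_ne_zero` (file `…KolyvaginDepthSupplyDoor`)
with Kolyvagin's Thm. 4 (`hF`) replaced by the displayed Euler-system / duality hypotheses and one
twist point. CONDITIONAL on those; per-curve; BSD is not proved by it.
[cite: Kolyvagin1991MathAnn, Thm. 2.3] [cite: JetchevLauterStein2009, §3.6 (arXiv:0707.0032)]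
[cite: GrossLMS1991, §10] -/
theorem shaCorank_eq_zero_of_rank_two_of_kolyvaginClass_prime_ne_zero_of_system (hcm : ¬ W.HasCM)
    (hK : IsImaginaryQuadratic K) (p : ℕ) [hp : Fact p.Prime] (hp2 : p ≠ 2)
    (htower : ∀ n : ℕ, W.HasSurjectiveModNGaloisRep (p ^ n : ℕ))
    (c : K ≃ₐ[ℚ] K) (hc : c ≠ 1) (hcc : c * c = 1)
    (d : ∀ n : ℕ, KolyvaginHeegnerData Dt β ι n) (ε : ℤ) (hε : ε = 1 ∨ ε = -1)
    (hτc : ∀ n : ℕ, Squarefree n →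
      (∀ q ∈ n.primeFactors, Zhang2014.IsKolyvaginPrime (W.conductorNorm ℤ) W K p q) →
      conjAct W c ((p ^ 1 : ℕ) : ℤ) ((d n).kolyvaginClass hp.out 1) =
        (ε * (-1) ^ n.primeFactors.card) • (d n).kolyvaginClass hp.out 1)
    (hfin : ∀ n : ℕ, Squarefree n →
      (∀ q ∈ n.primeFactors, Zhang2014.IsKolyvaginPrime (W.conductorNorm ℤ) W K p q) →
      ∀ v : HeightOneSpectrum (𝓞 K), (n : 𝓞 K) ∉ v.asIdeal →
        (d n).kolyvaginClass hp.out 1 ∈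
          selmerLocalKer (W.baseChange K) (v.adicCompletion K) ((p ^ 1 : ℕ) : ℤ))
    (hinf : ∀ n : ℕ, Squarefree n →
      (∀ q ∈ n.primeFactors, Zhang2014.IsKolyvaginPrime (W.conductorNorm ℤ) W K p q) →
      ∀ w : InfinitePlace K,
        (d n).kolyvaginClass hp.out 1 ∈ selmerLocalKer (W.baseChange K) w.Completion ((p ^ 1 : ℕ) : ℤ))
    (h44 : ∀ (ℓ m : ℕ), Squarefree (ℓ * m) →
      (∀ q ∈ (ℓ * m).primeFactors, Zhang2014.IsKolyvaginPrime (W.conductorNorm ℤ) W K p q) →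
      Zhang2014.IsKolyvaginPrime (W.conductorNorm ℤ) W K p ℓ →
      ∀ v : HeightOneSpectrum (𝓞 K), (ℓ : 𝓞 K) ∈ v.asIdeal →
        ((d (ℓ * m)).kolyvaginClass hp.out 1 ∈
            selmerLocalKer (W.baseChange K) (v.adicCompletion K) ((p ^ 1 : ℕ) : ℤ) ↔
          (d m).kolyvaginClass hp.out 1 ∈
            (W.baseChange K).torsionLocalKer (v.adicCompletion K) ((p ^ 1 : ℕ) : ℤ)))
    (hcyc : ∀ ℓ : ℕ, Zhang2014.IsKolyvaginPrime (W.conductorNorm ℤ) W K p ℓ →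
      ∀ e : ℤ, (e = 1 ∨ e = -1) →
      ∀ s₁ ∈ selmerGroup (W.baseChange K) ((p ^ 1 : ℕ) : ℤ),
        conjAct W c ((p ^ 1 : ℕ) : ℤ) s₁ = e • s₁ →
      ∀ s₂ ∈ selmerGroup (W.baseChange K) ((p ^ 1 : ℕ) : ℤ),
        conjAct W c ((p ^ 1 : ℕ) : ℤ) s₂ = e • s₂ →
      ∃ a b : ℤ, ¬ ((p : ℤ) ∣ a ∧ (p : ℤ) ∣ b) ∧
        ∀ v : HeightOneSpectrum (𝓞 K), (ℓ : 𝓞 K) ∈ v.asIdeal →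
          a • s₁ + b • s₂ ∈ (W.baseChange K).torsionLocalKer (v.adicCompletion K) ((p ^ 1 : ℕ) : ℤ))
    (hdual : ∀ (T : Finset ℕ), (∀ q ∈ T, Zhang2014.IsKolyvaginPrime (W.conductorNorm ℤ) W K p q) →
      ∀ ℓ ∈ T, ∀ e : ℤ, (e = 1 ∨ e = -1) →
      ∀ x : galH1Torsion (W.baseChange K) ((p ^ 1 : ℕ) : ℤ),
        conjAct W c ((p ^ 1 : ℕ) : ℤ) x = e • x →
        (∀ v : HeightOneSpectrum (𝓞 K), (∀ q ∈ T, (q : 𝓞 K) ∉ v.asIdeal) →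
          x ∈ selmerLocalKer (W.baseChange K) (v.adicCompletion K) ((p ^ 1 : ℕ) : ℤ)) →
        (∀ w : InfinitePlace K, x ∈ selmerLocalKer (W.baseChange K) w.Completion ((p ^ 1 : ℕ) : ℤ)) →
      ∀ s ∈ selmerGroup (W.baseChange K) ((p ^ 1 : ℕ) : ℤ),
        conjAct W c ((p ^ 1 : ℕ) : ℤ) s = e • s →
        (∀ q ∈ T, q ≠ ℓ → ∀ v : HeightOneSpectrum (𝓞 K), (q : 𝓞 K) ∈ v.asIdeal →
          s ∈ (W.baseChange K).torsionLocalKer (v.adicCompletion K) ((p ^ 1 : ℕ) : ℤ)) →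
        ∀ v : HeightOneSpectrum (𝓞 K), (ℓ : 𝓞 K) ∈ v.asIdeal →
          s ∉ (W.baseChange K).torsionLocalKer (v.adicCompletion K) ((p ^ 1 : ℕ) : ℤ) →
          x ∈ selmerLocalKer (W.baseChange K) (v.adicCompletion K) ((p ^ 1 : ℕ) : ℤ))
    {ℓ : ℕ} (hℓ : Zhang2014.IsKolyvaginPrime (W.conductorNorm ℤ) W K p ℓ)
    (hne : (d ℓ).kolyvaginClass hp.out 1 ≠ 0) (h2 : 2 ≤ W.mordellWeilRank)
    (h1 : 1 ≤ (W.quadraticTwist (NumberField.discr K : ℚ)).mordellWeilRank) :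
    W.shaCorank p = 0 ∧ W.mordellWeilRank = 2 ∧
      (W.quadraticTwist (NumberField.discr K : ℚ)).mordellWeilRank = 1 ∧
      (W.quadraticTwist (NumberField.discr K : ℚ)).shaCorank p = 0 := by
  have hcard : ℓ.primeFactors.card = 1 := by rw [hℓ.1.primeFactors, Finset.card_singleton]
  obtain ⟨hsha, hshaT, hra, hrb⟩ :=
    shaCorank_eq_zero_of_kolyvaginClass_ne_zero_of_points_of_system hcm hK p hp2 htower c hc hcc d ε
      hε hτc hfin hinf h44 hcyc hdual hℓ.1.squarefree (fun q hq ↦ by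
        rw [hℓ.1.primeFactors, Finset.mem_singleton] at hq
        exact hq ▸ hℓ) hne 2 1 (by rw [hcard]) h2 h1
  exact ⟨hsha, hra, hrb, hshaT⟩


end System

end Summit.BirchSwinnertonDyer.BirchSwinnertonDyer.Theorems.KolyvaginDepthDoor

end
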